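import Literature.MathematicalPhysics.QuantumManyBody.PeriodicBoseGasFourier
import HarnessLib

/-!
# Puff's cubic moment: the finite-sum algebra of the pair blocks

Topic `Literature/MathematicalPhysics/QuantumManyBody`; the pointwise (integration-free) algebra of
Puff's cubic energy-weighted moment of the density response [Puff1965, (12)–(15); Stringari1995,
§2.3 (23)] on the torus `(ℝ³/Lℤ³)^N`. Notation: mode `m`, `k = 2πm/L`, `κ = ‖k‖²`,
`eⱼ = e^{ik·xⱼ}` (`cellWave L m (X j)`), `E_{jl} = eⱼēₗ`, `∂ⱼ = k·∇_{xⱼ}` (derivative along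
`Pi.single j k`), real `u, V`, `A = ∑ⱼ eⱼ(κu - 2i∂ⱼu)`,
`B = ∑ⱼ eⱼ(κ²u - 4iκ∂ⱼu - 4∂ⱼ∂ⱼu + 2i(∂ⱼV)u)`, `α_{jl} = κ[j ≠ l]`.

* `conj_A_mul_B_eq_sum_blocks` — `conj(A) B = ∑_{j,l} E_{jl}(κu + 2i∂ₗu)(κ²u - 4iκ∂ⱼu - 4∂ⱼ∂ⱼu + 2i(∂ⱼV)u)`;
* `sum_blockTarget_eq` — the evaluated blocks summed over `l` and `j`:
  `N κ³u² + 12κ∑ⱼ(∂ⱼu)² + 2iκ∑ⱼ(∂ⱼV)u² + 2u²∑_{j,l}E_{jl}∂ₗ∂ⱼV` (`12 = 4 + 8`, `E_{jj} = 1`);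
* `puff_block_algebra` — the polynomial identity `block - target = ∂ⱼΦ₁ + ∂ₗΦ₂` behind the
  evaluation of one block by periodic integration by parts (`PuffCubicMomentBlocks.lean`).

No definitions; `[folklore]`.
-/

noncomputable section

open MeasureTheory
open scoped ENNReal NNReal ComplexConjugate

namespace Literature.MathematicalPhysics.QuantumManyBody.BoseGas

variable {N : ℕ} {L : ℝ} (m : Fin 3 → ℤ) {k : Space} {u V : Config N → ℝ}

/-! ### `conj(A) B` as a double sum of blocks -/

/-- `conj(A) B = ∑ⱼ ∑ₗ E_{jl} (κu + 2i∂ₗu)(κ²u - 4iκ∂ⱼu - 4∂ⱼ∂ⱼu + 2i(∂ⱼV)u)` pointwise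
(`u`, its derivatives and `κ` are real). [folklore] -/
theorem conj_A_mul_B_eq_sum_blocks (X : Config N) :
    conj (∑ j : Fin N, cellWave L m (X j) *
        ((((‖k‖ ^ 2 : ℝ) : ℂ)) * ((u X : ℝ) : ℂ) - 2 * Complex.I * ((fderiv ℝ u X (Pi.single j k) : ℝ) : ℂ))) *
      ∑ j : Fin N, cellWave L m (X j) *
        ((((‖k‖ ^ 2 : ℝ) : ℂ)) ^ 2 * ((u X : ℝ) : ℂ) -
          4 * Complex.I * ((‖k‖ ^ 2 : ℝ) : ℂ) * ((fderiv ℝ u X (Pi.single j k) : ℝ) : ℂ) -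
          4 * ((fderiv ℝ (fun Y => fderiv ℝ u Y (Pi.single j k)) X (Pi.single j k) : ℝ) : ℂ) +
          2 * Complex.I * ((fderiv ℝ V X (Pi.single j k) : ℝ) : ℂ) * ((u X : ℝ) : ℂ)) =
    ∑ j : Fin N, ∑ l : Fin N, cellWave L m (X j) * conj (cellWave L m (X l)) *
        (((((‖k‖ ^ 2 : ℝ) : ℂ)) * ((u X : ℝ) : ℂ) + 2 * Complex.I * ((fderiv ℝ u X (Pi.single l k) : ℝ) : ℂ)) *
          ((((‖k‖ ^ 2 : ℝ) : ℂ)) ^ 2 * ((u X : ℝ) : ℂ) -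
            4 * Complex.I * ((‖k‖ ^ 2 : ℝ) : ℂ) * ((fderiv ℝ u X (Pi.single j k) : ℝ) : ℂ) -
            4 * ((fderiv ℝ (fun Y => fderiv ℝ u Y (Pi.single j k)) X (Pi.single j k) : ℝ) : ℂ) +
            2 * Complex.I * ((fderiv ℝ V X (Pi.single j k) : ℝ) : ℂ) * ((u X : ℝ) : ℂ))) := by
  rw [map_sum, Finset.sum_mul_sum, Finset.sum_comm]
  refine Finset.sum_congr rfl fun j _ => Finset.sum_congr rfl fun l _ => ?_
  simp only [map_mul, map_sub, Complex.conj_ofReal, Complex.conj_I, map_ofNat]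
  ring

/-! ### Summation of the evaluated blocks -/

/-- The evaluated blocks summed over `l`, then `j`, pointwise:
`∑ⱼ∑ₗ E_{jl}(κ(κ-α)(κ-2α)u² + 4(κ-α)(∂ⱼu)² + 8(κ-α)∂ₗu∂ⱼu + 2i(κ-α)(∂ⱼV)u² + 2(∂ₗ∂ⱼV)u²)
 = Nκ³u² + 12κ∑ⱼ(∂ⱼu)² + 2iκ∑ⱼ(∂ⱼV)u² + 2u²∑ⱼ∑ₗE_{jl}∂ₗ∂ⱼV` (`α_{jl} = κ[j ≠ l]`, `E_{jj} = 1`).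
[folklore] -/
theorem sum_blockTarget_eq (X : Config N) :
    ∑ j : Fin N, ∑ l : Fin N, cellWave L m (X j) * conj (cellWave L m (X l)) *
        (((‖k‖ ^ 2 : ℝ) : ℂ) * (((‖k‖ ^ 2 : ℝ) : ℂ) - (((if j = l then (0 : ℝ) else ‖k‖ ^ 2) : ℝ) : ℂ)) *
            (((‖k‖ ^ 2 : ℝ) : ℂ) - 2 * (((if j = l then (0 : ℝ) else ‖k‖ ^ 2) : ℝ) : ℂ)) *
            (((u X : ℝ) : ℂ) * ((u X : ℝ) : ℂ)) +
          4 * (((‖k‖ ^ 2 : ℝ) : ℂ) - (((if j = l then (0 : ℝ) else ‖k‖ ^ 2) : ℝ) : ℂ)) *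
            (((fderiv ℝ u X (Pi.single j k) : ℝ) : ℂ) * ((fderiv ℝ u X (Pi.single j k) : ℝ) : ℂ)) +
          8 * (((‖k‖ ^ 2 : ℝ) : ℂ) - (((if j = l then (0 : ℝ) else ‖k‖ ^ 2) : ℝ) : ℂ)) *
            (((fderiv ℝ u X (Pi.single l k) : ℝ) : ℂ) * ((fderiv ℝ u X (Pi.single j k) : ℝ) : ℂ)) +
          2 * Complex.I * (((‖k‖ ^ 2 : ℝ) : ℂ) - (((if j = l then (0 : ℝ) else ‖k‖ ^ 2) : ℝ) : ℂ)) *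
            (((fderiv ℝ V X (Pi.single j k) : ℝ) : ℂ) * (((u X : ℝ) : ℂ) * ((u X : ℝ) : ℂ))) +
          2 * (((fderiv ℝ (fun Y => fderiv ℝ V Y (Pi.single j k)) X (Pi.single l k) : ℝ) : ℂ) *
            (((u X : ℝ) : ℂ) * ((u X : ℝ) : ℂ)))) =
      ((‖k‖ ^ 2 : ℝ) : ℂ) ^ 3 * N * (((u X : ℝ) : ℂ) * ((u X : ℝ) : ℂ)) +
        12 * ((‖k‖ ^ 2 : ℝ) : ℂ) *
          ∑ j : Fin N, ((fderiv ℝ u X (Pi.single j k) : ℝ) : ℂ) * ((fderiv ℝ u X (Pi.single j k) : ℝ) : ℂ) +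
        2 * Complex.I * ((‖k‖ ^ 2 : ℝ) : ℂ) *
          ∑ j : Fin N, ((fderiv ℝ V X (Pi.single j k) : ℝ) : ℂ) * (((u X : ℝ) : ℂ) * ((u X : ℝ) : ℂ)) +
        2 * ((((u X : ℝ) : ℂ) * ((u X : ℝ) : ℂ)) * ∑ j : Fin N, ∑ l : Fin N,
          cellWave L m (X j) * conj (cellWave L m (X l)) *
            ((fderiv ℝ (fun Y => fderiv ℝ V Y (Pi.single j k)) X (Pi.single l k) : ℝ) : ℂ)) := by
  set κ : ℂ := ((‖k‖ ^ 2 : ℝ) : ℂ) with hκ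
  set e : Fin N → ℂ := fun j => cellWave L m (X j) with he
  set uu : ℂ := ((u X : ℝ) : ℂ) * ((u X : ℝ) : ℂ) with huu
  set d : Fin N → ℂ := fun j => ((fderiv ℝ u X (Pi.single j k) : ℝ) : ℂ) with hd
  set Vj : Fin N → ℂ := fun j => ((fderiv ℝ V X (Pi.single j k) : ℝ) : ℂ) with hVj
  set Vjl : Fin N → Fin N → ℂ := fun j l =>
    ((fderiv ℝ (fun Y => fderiv ℝ V Y (Pi.single j k)) X (Pi.single l k) : ℝ) : ℂ) with hVjl
  -- each summand: diagonal part (only for `l = j`) plus the Hessian term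
  have hterm : ∀ j l : Fin N, e j * conj (e l) *
      (κ * (κ - (((if j = l then (0 : ℝ) else ‖k‖ ^ 2) : ℝ) : ℂ)) *
          (κ - 2 * (((if j = l then (0 : ℝ) else ‖k‖ ^ 2) : ℝ) : ℂ)) * uu +
        4 * (κ - (((if j = l then (0 : ℝ) else ‖k‖ ^ 2) : ℝ) : ℂ)) * (d j * d j) +
        8 * (κ - (((if j = l then (0 : ℝ) else ‖k‖ ^ 2) : ℝ) : ℂ)) * (d l * d j) +
        2 * Complex.I * (κ - (((if j = l then (0 : ℝ) else ‖k‖ ^ 2) : ℝ) : ℂ)) * (Vj j * uu) +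
        2 * (Vjl j l * uu)) =
      (if j = l then e j * conj (e l) * (κ ^ 3 * uu + 4 * κ * (d j * d j) + 8 * κ * (d l * d j) +
        2 * Complex.I * κ * (Vj j * uu)) else 0) + 2 * (uu * (e j * conj (e l) * Vjl j l)) := by
    intro j l
    split_ifs with hjl
    · push_cast; ring
    · simp only [hκ]; push_cast; ring
  have hdiag : ∀ j : Fin N, e j * conj (e j) = 1 := fun j => by
    rw [he, Complex.mul_conj, Complex.normSq_eq_norm_sq, norm_cellWave]; simp
  calc _ = ∑ j : Fin N, ∑ l : Fin N, ((if j = l then e j * conj (e l) * (κ ^ 3 * uu + 4 * κ * (d j * d j) +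
        8 * κ * (d l * d j) + 2 * Complex.I * κ * (Vj j * uu)) else 0) + 2 * (uu * (e j * conj (e l) * Vjl j l))) :=
        Finset.sum_congr rfl fun j _ => Finset.sum_congr rfl fun l _ => hterm j l
    _ = ∑ j : Fin N, ((κ ^ 3 * uu + 12 * κ * (d j * d j) + 2 * Complex.I * κ * (Vj j * uu)) +
        2 * (uu * ∑ l : Fin N, e j * conj (e l) * Vjl j l)) := by
        refine Finset.sum_congr rfl fun j _ => ?_
        rw [Finset.sum_add_distrib, Finset.sum_ite_eq, if_pos (Finset.mem_univ j), hdiag, Finset.mul_sum,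
          Finset.mul_sum]
        ring
    _ = _ := by
        simp only [Finset.sum_add_distrib, Finset.mul_sum, Finset.sum_const, Finset.card_univ,
          Fintype.card_fin, nsmul_eq_mul, he, hd, hVj, hVjl, huu, hκ]
        ring_nf

/-! ### The algebra of one block -/

/-- The polynomial identity behind `puff_block_pointwise` (real atoms `u = u(X)`, `d = ∂ⱼu`,
`d' = ∂ₗu`, `dd = ∂ⱼ∂ⱼu`, `d'd = ∂ₗ∂ⱼu`, `Vj = ∂ⱼV`, `Vjl = ∂ₗ∂ⱼV`; `κ = ‖k‖²`, `α = α_{jl}`):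
block `- ` target `=` (derivative of the flux `Φ₁` along `j`) `+` (derivative of `Φ₂` along `l`).
[folklore] -/
theorem puff_block_algebra (E : ℂ) (κ α u d d' dd d'd Vj Vjl : ℝ) :
    E * (((κ : ℂ) * u + 2 * Complex.I * d') * ((κ : ℂ) ^ 2 * u - 4 * Complex.I * κ * d - 4 * dd +
        2 * Complex.I * Vj * u)) =
      E * ((κ : ℂ) * (κ - α) * (κ - 2 * α) * (u * u) + 4 * ((κ : ℂ) - α) * (d * d) +
          8 * ((κ : ℂ) - α) * (d' * d) + 2 * Complex.I * ((κ : ℂ) - α) * (Vj * (u * u)) +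
          2 * (Vjl * (u * u))) +
      ((Complex.I * α * E) * ((-2 * Complex.I * κ ^ 2 + 2 * Complex.I * κ * α) * ((u : ℂ) * u) +
          (-4 * (κ : ℂ)) * ((u : ℂ) * d) + (-8 * Complex.I) * ((d' : ℂ) * d)) +
        E * ((-2 * Complex.I * κ ^ 2 + 2 * Complex.I * κ * α) * ((d : ℂ) * u + u * d) +
          (-4 * (κ : ℂ)) * ((d : ℂ) * d + u * dd) + (-8 * Complex.I) * ((d'd : ℂ) * d + d' * dd))) +
      ((-(Complex.I * α * E)) * ((Complex.I * κ ^ 2) * ((u : ℂ) * u) + (4 * Complex.I) * ((d : ℂ) * d) +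
          (-2) * ((Vj : ℂ) * (u * u))) +
        E * ((Complex.I * κ ^ 2) * ((d' : ℂ) * u + u * d') + (4 * Complex.I) * ((d'd : ℂ) * d + d * d'd) +
          (-2) * ((Vjl : ℂ) * (u * u) + Vj * ((d' : ℂ) * u + u * d')))) := by
  have hI : Complex.I ^ 2 = -1 := Complex.I_sq
  linear_combination (E * (-8 * (κ : ℂ) * d' * d + 4 * Vj * u * d' + 3 * α * κ ^ 2 * (u * u) -
    2 * κ * α * α * (u * u) + 8 * α * (d' * d) + 4 * α * (d * d))) * hI


end Literature.MathematicalPhysics.QuantumManyBody.BoseGas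

end
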